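import Mathlib
import Summits.Ventures.DiscreteObjects.Mahler.TracePairStructure
import Summits.Ventures.DiscreteObjects.Mahler.TraceNu2Certificate

/-!
# `ν = 3` trace certificate: one real trace root outside `[-2, 2]` and one complex pair (venture `DiscreteObjects`, target L)

Cell `pub-namedobj`, seat `pub-namedobj-mahler` (gen 11). Framing: lottery ticket; floor = certified
bounds/negative ranges.

Ten census cores of degrees `14–18` (`c14_09`, `c14_10`, `c18_03`, `c18_06`, `c18_08`, `c18_11`, `c18_13`, `c18_15`,
`c18_19`, `c18_23`) have `ν = 3` roots outside the unit circle: their trace polynomial `Q` (degree `d`) has `d - 3`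
real roots in `(-2, 2)`, ONE real root `t₀` with `|t₀| > 2`, and ONE complex-conjugate pair.  Then
`M(traceLift Q) = x₀ · r²` with `x₀ + x₀⁻¹ = |t₀|` and `r + r⁻¹ = (√h₊ + √h₋)/2`, where `h₊, h₋ > 0` are the
values at `±2` of the monic quadratic cofactor (`tracePair_structure`, file `TracePairStructure`).

* `nu3_certificate_of_signs` — the certificate from RATIONAL DATA: `d - 3` inner sign-change brackets, one outer
  bracket `(a₀, b₀)` (with `b₀ < -2` or `2 < a₀`) carrying rational bounds `m₀ ≤ |t| ≤ M₀`, `u₁ ≤ |2 - t| ≤ u₂`,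
  `v₁ ≤ |2 + t| ≤ v₂` on it, the sign conditions `(2 - a₀)·Q(2) > 0`, `(-1)^d (2 + a₀)·Q(-2) > 0`, a box
  `[pL, pU] × [mL, mU]` for `(h₊, h₋)` witnessed by `pL·u₂·∏(2 - a) ≤ |Q(2)| ≤ pU·u₁·∏(2 - b)` and
  `mL·v₂·∏(2 + b) ≤ |Q(-2)| ≤ mU·v₁·∏(2 + a)`, the non-real criterion on the box, square-root witnesses
  `s₁² ≤ pL ≤ pU ≤ s₂²`, `s₃² ≤ mL ≤ mU ≤ s₄²`, and brackets `xL < x₀ < xU`, `rL < r < rU` obtained through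
  `x + x⁻¹`; conclusion `lo < M(traceLift Q) < hi` for `lo ≤ xL·rL²`, `xU·rU² ≤ hi`.  Every hypothesis is a
  `norm_num` fact (the outer-bracket bounds after one `abs_of_pos`/`abs_of_neg`).
-/

namespace Summit.Ventures.DiscreteObjects.Mahler

open Polynomial

/-- **`ν = 3` certificate from rational data** (one outer real trace root and one complex pair); see the file
docstring for the meaning of the data.  Conclusion: `lo < M(traceLift Q) < hi`. -/
theorem nu3_certificate_of_signs {Q : ℤ[X]} (hQ : Q.Monic) (I : List (ℝ × ℝ)) {a₀ b₀ : ℝ}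
    (hlen : I.length + 3 = Q.natDegree)
    (hI : ∀ ab ∈ I, -2 < ab.1 ∧ ab.1 < ab.2 ∧ ab.2 < 2)
    (hsorted : I.Pairwise (fun ab cd => ab.2 ≤ cd.1))
    (hsign : ∀ ab ∈ I, aeval ab.1 Q * aeval ab.2 Q < 0)
    (hab₀ : a₀ < b₀) (hout : b₀ < -2 ∨ 2 < a₀) (hsign₀ : aeval a₀ Q * aeval b₀ Q < 0)
    {m₀ M₀ u₁ u₂ v₁ v₂ : ℝ} (hm₀ : 2 < m₀) (hu₁ : 0 < u₁) (hv₁ : 0 < v₁)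
    (houter : ∀ t : ℝ, a₀ < t → t < b₀ →
      m₀ ≤ |t| ∧ |t| ≤ M₀ ∧ u₁ ≤ |2 - t| ∧ |2 - t| ≤ u₂ ∧ v₁ ≤ |2 + t| ∧ |2 + t| ≤ v₂)
    (hQ2 : 0 < (2 - a₀) * aeval (2 : ℝ) Q) (hQm2 : 0 < (-1) ^ Q.natDegree * (2 + a₀) * aeval (-2 : ℝ) Q)
    {pL pU mL mU : ℝ} (hpL0 : 0 ≤ pL) (hmL0 : 0 ≤ mL)
    (hpL : pL * (u₂ * (I.map fun ab => 2 - ab.1).prod) ≤ |aeval (2 : ℝ) Q|)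
    (hpU : |aeval (2 : ℝ) Q| ≤ pU * (u₁ * (I.map fun ab => 2 - ab.2).prod))
    (hmL : mL * (v₂ * (I.map fun ab => 2 + ab.2).prod) ≤ |aeval (-2 : ℝ) Q|)
    (hmU : |aeval (-2 : ℝ) Q| ≤ mU * (v₁ * (I.map fun ab => 2 + ab.1).prod))
    (hcrit₁ : (mL - pU) ^ 2 < 32 * (pL + mL) - 256) (hcrit₂ : (mU - pL) ^ 2 < 32 * (pL + mL) - 256)
    {s₁ s₂ s₃ s₄ xL xU rL rU lo hi : ℝ}
    (hs₁ : s₁ ^ 2 ≤ pL) (hs₂ : 0 ≤ s₂) (hs₂' : pU ≤ s₂ ^ 2) (hs₃ : s₃ ^ 2 ≤ mL) (hs₄ : 0 ≤ s₄)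
    (hs₄' : mU ≤ s₄ ^ 2)
    (hxL : 1 ≤ xL) (hxL' : xL + xL⁻¹ < m₀) (hxU : 1 ≤ xU) (hxU' : M₀ < xU + xU⁻¹)
    (hrL : 1 ≤ rL) (hrL' : rL + rL⁻¹ < (s₁ + s₃) / 2) (hrU : 1 ≤ rU) (hrU' : (s₂ + s₄) / 2 < rU + rU⁻¹)
    (hlo : lo ≤ xL * rL ^ 2) (hhi : xU * rU ^ 2 ≤ hi) :
    lo < intMahlerMeasure (traceLift Q) ∧ intMahlerMeasure (traceLift Q) < hi := by
  classical
  set g : ℝ → ℝ := fun y => aeval y Q with hgdef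
  have hg : Continuous g := by
    rw [hgdef]; simp only [← eval_map_algebraMap]; exact Polynomial.continuous _
  obtain ⟨rs, hrslen, hrspw, hroots, hp1, hp2, hp3, hp4⟩ := exists_roots_in_intervals hg I hI hsorted hsign
  have hrs2 : ∀ r ∈ rs, -2 < r ∧ r < 2 := by
    intro r hr
    obtain ⟨-, cd, hcd, h1, h2⟩ := hroots r hr
    obtain ⟨h3, -, h4⟩ := hI cd hcd
    exact ⟨by linarith, by linarith⟩
  -- the outer root
  obtain ⟨t₀, hat, htb, hgt⟩ := exists_root_of_mul_neg hg hab₀ hsign₀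
  obtain ⟨hm₀t, hM₀t, hu₁t, hu₂t, hv₁t, hv₂t⟩ := houter t₀ hat htb
  have ht₀abs : 2 < |t₀| := lt_of_lt_of_le hm₀ hm₀t
  have ht₀2 : 0 < (2 - t₀) * (2 - a₀) := by
    rcases hout with h | h
    · exact mul_pos (by linarith) (by linarith)
    · exact mul_pos_of_neg_of_neg (by linarith) (by linarith)
  have ht₀m2 : 0 < (2 + t₀) * (2 + a₀) := by
    rcases hout with h | h
    · exact mul_pos_of_neg_of_neg (by linarith) (by linarith)
    · exact mul_pos (by linarith) (by linarith)
  have ht₀rs : t₀ ∉ rs := by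
    intro h
    obtain ⟨h1, h2⟩ := hrs2 t₀ h
    rcases hout with h | h <;> linarith
  -- the multiset of certified real roots
  set T : Multiset ℝ := t₀ ::ₘ (rs : Multiset ℝ) with hT
  have hTnodup : T.Nodup := by
    rw [hT, Multiset.nodup_cons]
    exact ⟨by rwa [Multiset.mem_coe], Multiset.coe_nodup.mpr (hrspw.imp ne_of_lt)⟩
  have hTcard : Multiset.card T + 2 = Q.natDegree := by
    rw [hT, Multiset.card_cons, Multiset.coe_card, hrslen, ← hlen]
  have hTroot : ∀ t ∈ T, aeval t Q = 0 := by
    intro t ht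
    rw [hT, Multiset.mem_cons, Multiset.mem_coe] at ht
    rcases ht with rfl | ht
    · exact hgt
    · exact (hroots t ht).1
  have hT2 : ∀ t ∈ T, t ≠ 2 ∧ t ≠ -2 := by
    intro t ht
    rw [hT, Multiset.mem_cons, Multiset.mem_coe] at ht
    rcases ht with rfl | ht
    · rcases hout with h | h
      · exact ⟨by linarith, by linarith⟩
      · exact ⟨by linarith, by linarith⟩
    · obtain ⟨h1, h2⟩ := hrs2 t ht
      exact ⟨by linarith, by linarith⟩
  -- products
  set Pp : ℝ := (rs.map fun r => 2 - r).prod with hPp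
  set Pm : ℝ := (rs.map fun r => 2 + r).prod with hPm
  have hPp_pos : 0 < Pp :=
    List.prod_pos fun x hx => by obtain ⟨r, hr, rfl⟩ := List.mem_map.mp hx; linarith [(hrs2 r hr).2]
  have hPm_pos : 0 < Pm :=
    List.prod_pos fun x hx => by obtain ⟨r, hr, rfl⟩ := List.mem_map.mp hx; linarith [(hrs2 r hr).1]
  have hGp : (T.map fun t => 2 - t).prod = (2 - t₀) * Pp := by
    rw [hT, Multiset.map_cons, Multiset.prod_cons, Multiset.map_coe, Multiset.prod_coe]
  have hGneg : (T.map fun t => -2 - t).prod = (-2 - t₀) * ((-1) ^ rs.length * Pm) := by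
    rw [hT, Multiset.map_cons, Multiset.prod_cons]
    congr 1
    have : ((rs : Multiset ℝ).map fun t => -2 - t) = ((rs : Multiset ℝ).map fun t => 2 + t).map Neg.neg := by
      rw [Multiset.map_map]; exact Multiset.map_congr rfl fun t _ => by simp only [Function.comp_apply]; ring
    rw [this, Multiset.prod_map_neg, Multiset.card_map, Multiset.coe_card, Multiset.map_coe, Multiset.prod_coe]
  -- `h₊`, `h₋`
  set hp : ℝ := aeval (2 : ℝ) Q / ((2 - t₀) * Pp) with hhpdef
  set hm : ℝ := aeval (-2 : ℝ) Q / ((-2 - t₀) * ((-1) ^ rs.length * Pm)) with hhmdef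
  have ht₀ne : 2 - t₀ ≠ 0 := by
    intro h; rw [h, zero_mul] at ht₀2; exact lt_irrefl _ ht₀2
  have ht₀ne' : 2 + t₀ ≠ 0 := by
    intro h; rw [h, zero_mul] at ht₀m2; exact lt_irrefl _ ht₀m2
  have hden_p : (2 - t₀) * Pp ≠ 0 := mul_ne_zero ht₀ne hPp_pos.ne'
  have hden_m : (-2 - t₀) * ((-1) ^ rs.length * Pm) ≠ 0 := by
    refine mul_ne_zero ?_ (mul_ne_zero (pow_ne_zero _ (by norm_num)) hPm_pos.ne')
    intro h; apply ht₀ne'; linarith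
  have hhp : hp * (T.map fun t => 2 - t).prod = aeval (2 : ℝ) Q := by rw [hGp]; exact div_mul_cancel₀ _ hden_p
  have hhm : hm * (T.map fun t => -2 - t).prod = aeval (-2 : ℝ) Q := by rw [hGneg]; exact div_mul_cancel₀ _ hden_m
  -- positivity of `h₊`, `h₋`
  have hp_pos : 0 < hp := by
    have h2 : 0 < (2 - t₀) * Pp * (2 - a₀) := by
      rw [mul_right_comm]; exact mul_pos ht₀2 hPp_pos
    have h1 : 0 < hp * ((2 - t₀) * Pp * (2 - a₀)) := by
      have : hp * ((2 - t₀) * Pp * (2 - a₀)) = (2 - a₀) * aeval (2 : ℝ) Q := by rw [← hhp, hGp]; ring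
      rw [this]; exact hQ2
    rcases pos_and_pos_or_neg_and_neg_of_mul_pos h1 with ⟨h, -⟩ | ⟨-, h⟩
    · exact h
    · exact absurd h (not_lt.mpr h2.le)
  have hm_pos : 0 < hm := by
    have hlen' : Q.natDegree = rs.length + 3 := by rw [hrslen, hlen]
    have h2 : 0 < (-2 - t₀) * ((-1) ^ rs.length * Pm) * ((-1) ^ Q.natDegree * (2 + a₀)) := by
      rw [hlen']
      have : (-2 - t₀) * ((-1) ^ rs.length * Pm) * ((-1) ^ (rs.length + 3) * (2 + a₀)) =
          ((2 + t₀) * (2 + a₀)) * Pm * ((-1) ^ rs.length * (-1) ^ rs.length) := by ring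
      rw [this, ← pow_add, ← two_mul, pow_mul]
      norm_num
      exact mul_pos ht₀m2 hPm_pos
    have h1 : 0 < hm * ((-2 - t₀) * ((-1) ^ rs.length * Pm) * ((-1) ^ Q.natDegree * (2 + a₀))) := by
      have : hm * ((-2 - t₀) * ((-1) ^ rs.length * Pm) * ((-1) ^ Q.natDegree * (2 + a₀))) =
          (-1) ^ Q.natDegree * (2 + a₀) * aeval (-2 : ℝ) Q := by rw [← hhm, hGneg]; ring
      rw [this]; exact hQm2
    rcases pos_and_pos_or_neg_and_neg_of_mul_pos h1 with ⟨h, -⟩ | ⟨-, h⟩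
    · exact h
    · exact absurd h (not_lt.mpr h2.le)
  -- absolute values and the box
  have hQ2abs : |aeval (2 : ℝ) Q| = hp * (|2 - t₀| * Pp) := by
    rw [← hhp, hGp, abs_mul, abs_mul, abs_of_pos hp_pos, abs_of_pos hPp_pos]
  have hQm2abs : |aeval (-2 : ℝ) Q| = hm * (|2 + t₀| * Pm) := by
    rw [← hhm, hGneg, abs_mul, abs_mul, abs_mul, abs_of_pos hm_pos, abs_pow, abs_neg, abs_one, one_pow,
      one_mul, abs_of_pos hPm_pos, show -2 - t₀ = -(2 + t₀) by ring, abs_neg]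
  have hQ2pos : 0 < |aeval (2 : ℝ) Q| := by
    rw [hQ2abs]; exact mul_pos hp_pos (mul_pos (lt_of_lt_of_le hu₁ hu₁t) hPp_pos)
  have hQm2pos : 0 < |aeval (-2 : ℝ) Q| := by
    rw [hQm2abs]; exact mul_pos hm_pos (mul_pos (lt_of_lt_of_le hv₁ hv₁t) hPm_pos)
  have hPa : 0 ≤ (I.map fun ab => 2 - ab.2).prod :=
    List.prod_nonneg fun x hx => by obtain ⟨cd, hcd, rfl⟩ := List.mem_map.mp hx; linarith [(hI cd hcd).2.2]
  have hPb : 0 ≤ (I.map fun ab => 2 + ab.1).prod :=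
    List.prod_nonneg fun x hx => by obtain ⟨cd, hcd, rfl⟩ := List.mem_map.mp hx; linarith [(hI cd hcd).1]
  have hpU0 : 0 < pU := by
    by_contra hneg
    have : pU * (u₁ * (I.map fun ab => 2 - ab.2).prod) ≤ 0 :=
      mul_nonpos_of_nonpos_of_nonneg (not_lt.mp hneg) (mul_nonneg hu₁.le hPa)
    linarith
  have hmU0 : 0 < mU := by
    by_contra hneg
    have : mU * (v₁ * (I.map fun ab => 2 + ab.1).prod) ≤ 0 :=
      mul_nonpos_of_nonpos_of_nonneg (not_lt.mp hneg) (mul_nonneg hv₁.le hPb)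
    linarith
  have hGabs_p : 0 < |2 - t₀| * Pp := mul_pos (lt_of_lt_of_le hu₁ hu₁t) hPp_pos
  have hGabs_m : 0 < |2 + t₀| * Pm := mul_pos (lt_of_lt_of_le hv₁ hv₁t) hPm_pos
  have hpL' : pL ≤ hp := by
    have h1 : pL * (|2 - t₀| * Pp) ≤ hp * (|2 - t₀| * Pp) := by
      rw [← hQ2abs]
      calc pL * (|2 - t₀| * Pp) ≤ pL * (u₂ * (I.map fun ab => 2 - ab.1).prod) :=
            mul_le_mul_of_nonneg_left (mul_le_mul hu₂t hp1 hPp_pos.le (le_trans hu₁.le hu₁t |>.trans hu₂t)) hpL0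
        _ ≤ |aeval 2 Q| := hpL
    exact le_of_mul_le_mul_right h1 hGabs_p
  have hpU' : hp ≤ pU := by
    have h1 : hp * (|2 - t₀| * Pp) ≤ pU * (|2 - t₀| * Pp) := by
      rw [← hQ2abs]
      calc |(aeval 2 Q : ℝ)| ≤ pU * (u₁ * (I.map fun ab => 2 - ab.2).prod) := hpU
        _ ≤ pU * (|2 - t₀| * Pp) := mul_le_mul_of_nonneg_left (mul_le_mul hu₁t hp2 hPa (abs_nonneg _)) hpU0.le
    exact le_of_mul_le_mul_right h1 hGabs_p
  have hmL' : mL ≤ hm := by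
    have h1 : mL * (|2 + t₀| * Pm) ≤ hm * (|2 + t₀| * Pm) := by
      rw [← hQm2abs]
      calc mL * (|2 + t₀| * Pm) ≤ mL * (v₂ * (I.map fun ab => 2 + ab.2).prod) :=
            mul_le_mul_of_nonneg_left (mul_le_mul hv₂t hp4 hPm_pos.le (le_trans hv₁.le hv₁t |>.trans hv₂t)) hmL0
        _ ≤ |aeval (-2) Q| := hmL
    exact le_of_mul_le_mul_right h1 hGabs_m
  have hmU' : hm ≤ mU := by
    have h1 : hm * (|2 + t₀| * Pm) ≤ mU * (|2 + t₀| * Pm) := by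
      rw [← hQm2abs]
      calc |(aeval (-2) Q : ℝ)| ≤ mU * (v₁ * (I.map fun ab => 2 + ab.1).prod) := hmU
        _ ≤ mU * (|2 + t₀| * Pm) := mul_le_mul_of_nonneg_left (mul_le_mul hv₁t hp3 hPb (abs_nonneg _)) hmU0.le
    exact le_of_mul_le_mul_right h1 hGabs_m
  have hcrit : (hm - hp) ^ 2 < 32 * (hp + hm) - 256 := by
    have h1 := sq_le_max_sq_of_mem (x := hm - hp) (α := mL - pU) (β := mU - pL) (by linarith) (by linarith)
    have h2 : max ((mL - pU) ^ 2) ((mU - pL) ^ 2) < 32 * (pL + mL) - 256 := max_lt hcrit₁ hcrit₂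
    linarith
  -- structure theorem
  obtain ⟨r, hr1, hrA, -, -, hM⟩ := tracePair_structure hQ T hTnodup hTcard hTroot hT2 hhp hhm hcrit
  -- the product over `T` is `x₀`
  set x₀ : ℝ := (|t₀| + Real.sqrt (t₀ ^ 2 - 4)) / 2 with hx₀
  obtain ⟨hx₀1, hx₀A⟩ := quadRoot_add_inv ht₀abs
  have hprodT : (T.map fun t => if |t| ≤ 2 then (1 : ℝ) else (|t| + Real.sqrt (t ^ 2 - 4)) / 2).prod = x₀ := by
    rw [hT, Multiset.map_cons, Multiset.prod_cons, if_neg (not_le.mpr ht₀abs)]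
    have : ((rs : Multiset ℝ).map fun t => if |t| ≤ 2 then (1 : ℝ) else (|t| + Real.sqrt (t ^ 2 - 4)) / 2) =
        (rs : Multiset ℝ).map fun _ => (1 : ℝ) :=
      Multiset.map_congr rfl fun t ht => by
        rw [Multiset.mem_coe] at ht
        rw [if_pos (abs_le.mpr ⟨(hrs2 t ht).1.le, (hrs2 t ht).2.le⟩)]
    rw [this, Multiset.map_const', Multiset.prod_replicate, one_pow, mul_one]
  rw [hprodT] at hM
  -- brackets for `x₀` and `r`
  have hxL'' : xL < x₀ := lt_of_add_inv_lt_add_inv hx₀1.le (by linarith) (by rw [hx₀A]; linarith)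
  have hxU'' : x₀ < xU := lt_of_add_inv_lt_add_inv hxU (by linarith) (by rw [hx₀A]; linarith)
  have hs1 : s₁ ≤ Real.sqrt hp := Real.le_sqrt_of_sq_le (le_trans hs₁ hpL')
  have hs3 : s₃ ≤ Real.sqrt hm := Real.le_sqrt_of_sq_le (le_trans hs₃ hmL')
  have hs2 : Real.sqrt hp ≤ s₂ := by
    rw [← Real.sqrt_sq hs₂]; exact Real.sqrt_le_sqrt (le_trans hpU' hs₂')
  have hs4 : Real.sqrt hm ≤ s₄ := by
    rw [← Real.sqrt_sq hs₄]; exact Real.sqrt_le_sqrt (le_trans hmU' hs₄')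
  have hrL'' : rL < r := lt_of_add_inv_lt_add_inv hr1.le (by linarith) (by rw [hrA]; linarith)
  have hrU'' : r < rU := lt_of_add_inv_lt_add_inv hrU (by linarith) (by rw [hrA]; linarith)
  rw [hM]
  have hrL0 : 0 ≤ rL := zero_le_one.trans hrL
  have hr0 : 0 < r := zero_lt_one.trans hr1
  have hxL0 : 0 ≤ xL := zero_le_one.trans hxL
  have hx₀0 : 0 < x₀ := zero_lt_one.trans hx₀1
  constructor
  · calc lo ≤ xL * rL ^ 2 := hlo
      _ ≤ xL * r ^ 2 := mul_le_mul_of_nonneg_left (pow_le_pow_left₀ hrL0 hrL''.le 2) hxL0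
      _ < x₀ * r ^ 2 := mul_lt_mul_of_pos_right hxL'' (pow_pos hr0 2)
  · calc x₀ * r ^ 2 < xU * r ^ 2 := mul_lt_mul_of_pos_right hxU'' (pow_pos hr0 2)
      _ ≤ xU * rU ^ 2 := mul_le_mul_of_nonneg_left (pow_le_pow_left₀ hr0.le hrU''.le 2) (zero_le_one.trans hxU)
      _ ≤ hi := hhi

end Summit.Ventures.DiscreteObjects.Mahler
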